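import Summits.FinalStateConjecture.FinalStateConjecture.Theorems.ZeroEnergyKerrOrBombStationaryLimitReductionRecutCoveringJunctionCore
import Literature.Geometry.Lorentzian.KerrWaveEnergy
import HarnessLib

/-!
# Route ZeroEnergyKerrOrBomb · crux `FinalStateFromKerrOrBomb` (stmt-FinalStateConjecture-17839), line
# `SketchIdeator1` — stub `stub_recutJunctionCoreCO`, wave 5: the SIGN of an untilted motion — `Λᵢ e₀ = e₀` from
# clauses (ℓ) + (e′) of `IsChartOverlapCompatible`

Helper file (`--supports stmt-FinalStateConjecture-17839`; registered helper `recutJunction_isochronous`) of the lead's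
wave-5 stub worker W16 (2026-08-17); companion of `…RecutCoreCOIsochronous.lean` (`recutJunction_noTilt`: under clause
(iii) + (a) + (e⁺) no motion tilts the time axis, `(Λᵢ⁻¹ e₀)_{space} = 0`, taken here as a HYPOTHESIS), of
`…RecutCoreCOFlatSteer.lean` (p146004) and `…RecutCoreCOAssembly.lean`. See `work/stubs/W16-report.md`.

Content. If `(Λ⁻¹ e₀)_{space} = 0` then `Λ⁻¹ e₀ = ±e₀` (`η(Λ⁻¹ e₀, Λ⁻¹ e₀) = −1`). The sign `−` (a time-reversing motion,
lab time `= cᵢ⁰ −` rest time) is excluded by clause (ℓ) — "eventually in lab time, coordinates within the excision scale of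
hole `i` are rest-late" — together with (e′) (`ρᵢ → ∞`): sliding a fixed identification point `Θᵢ x` BACKWARDS in
Kerr–Schild time keeps its adapted radius, makes its lab time `→ +∞` and its rest time `→ −∞`. Hence `Λᵢ e₀ = e₀`
(`recutJunction_isochronous`), the "isochronous motions" hypothesis of the assembly `recutJunctionCoreCO_of_isochronous`.

Elementary; no named fact, nothing restated. Reference: Dafermos–Luk arXiv:1710.01722, Conjecture 1 (b)–(c)
(late-time multi-chart bookkeeping; formalisation-internal).
-/

set_option linter.dupNamespace false

noncomputable section

open scoped Manifold ContDiff Topology RealInnerProductSpace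
open Set Filter Function

namespace Summit.FinalStateConjecture.FinalStateConjecture.Theorems.SymplecticDualOfTheBomb

open Literature.Geometry.Lorentzian Summit.FinalStateConjecture.FinalStateConjecture.Theorems.OneLockedExplosion

/-! ## §1 Lorentz algebra (private copies of the companion file's §1, unbuilt today) -/

section Lorentz

variable (Λ : lorentzGroup)

/-- `η(v, w) = −v⁰ w⁰ + ⟪v_{space}, w_{space}⟫`. [folklore] -/
private theorem minkowski_eq_inner_w5s (v w : E4) :
    Minkowski.bilin v w = -(v 0 * w 0) + ⟪E4.spatial v, E4.spatial w⟫ := by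
  rw [Minkowski.bilin_apply, real_inner_comm, PiLp.inner_apply]
  simp [Fin.sum_univ_three, E4.spatial_apply]

/-- Private copy of `lorentz_apply_zero_eq` (…RecutCoreCOIsochronous, unbuilt today): lab time through the pulled-back
time axis, `(Λ w)⁰ = ũ⁰ w⁰ − ⟪ũ_{sp}, w_{sp}⟫`, `ũ := Λ⁻¹ e₀`. [folklore] -/
private theorem lorentz_apply_zero_eq_w5s (w : E4) :
    (Λ : E4 ≃L[ℝ] E4) w 0 = (Λ : E4 ≃L[ℝ] E4).symm (E4.basisVector 0) 0 * w 0 -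
      ⟪E4.spatial ((Λ : E4 ≃L[ℝ] E4).symm (E4.basisVector 0)), E4.spatial w⟫ := by
  have h := Λ.2 ((Λ : E4 ≃L[ℝ] E4).symm (E4.basisVector 0)) w
  rw [ContinuousLinearEquiv.apply_symm_apply, Minkowski.bilin_basisVector_zero_left, minkowski_eq_inner_w5s] at h
  linarith

/-- The pulled-back time axis is a unit timelike vector: `−(ũ⁰)² + ‖ũ_{sp}‖² = −1`. [folklore] -/
theorem lorentz_symm_basisVector_sq :
    -((Λ : E4 ≃L[ℝ] E4).symm (E4.basisVector 0) 0) ^ 2 +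
      ‖E4.spatial ((Λ : E4 ≃L[ℝ] E4).symm (E4.basisVector 0))‖ ^ 2 = -1 := by
  have h := Λ.2 ((Λ : E4 ≃L[ℝ] E4).symm (E4.basisVector 0)) ((Λ : E4 ≃L[ℝ] E4).symm (E4.basisVector 0))
  rw [ContinuousLinearEquiv.apply_symm_apply, Minkowski.bilin_basisVector_zero, minkowski_eq_inner_w5s,
    real_inner_self_eq_norm_sq] at h
  nlinarith [h]

/-- A vector of `E4` is determined by its time and spatial parts: if `u⁰ = t` and `u_{space} = 0` then `u = t e₀`.
[folklore] -/
theorem eq_smul_basisVector_of_spatial_eq_zero {u : E4} (hsp : E4.spatial u = 0) : u = u 0 • E4.basisVector 0 := by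
  have h := E4.ofTimeSpace_time_spatial u
  rw [hsp, E4.time_apply, ← E4.ofTimeSpace_zero_add_smul (0 : E3) (u 0)] at h
  have h0 : E4.ofTimeSpace 0 (0 : E3) = 0 := by
    ext j
    refine Fin.cases ?_ (fun i ↦ ?_) j <;> simp
  rw [h0, zero_add] at h
  exact h.symm

end Lorentz

/-! ## §2 The sign from (ℓ) + (e′) -/

section Sign

variable {𝓢 : Spacetime.{0} 4} {O : Set 𝓢.carrier} {k : ℕ}

/-- Far points of the Kerr–Schild chart (private copy of `exists_radius_ge_w4`, …RecutPastBoundaryTimeScale, unbuilt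
today): for every `ρ₀` there is `u` with `r(u) ≥ ρ₀`. [folklore] -/
private theorem exists_radius_ge_w5s (a ρ₀ : ℝ) : ∃ u : E4, ρ₀ ≤ Kerr.radius a u := by
  set y : E3 := EuclideanSpace.single 0 (|ρ₀| + |a|) with hy
  have hny : ‖y‖ = |ρ₀| + |a| := by
    rw [hy, EuclideanSpace.single, PiLp.norm_single, Real.norm_eq_abs, abs_of_nonneg (by positivity)]
  refine ⟨E4.ofTimeSpace 0 y, ?_⟩
  have h1 := Kerr.spatialNorm_sq_sub_sq_le_radius_sq a (E4.ofTimeSpace 0 y)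
  rw [E4.spatialNorm_ofTimeSpace, hny] at h1
  have h2 : ρ₀ ^ 2 ≤ Kerr.radius a (E4.ofTimeSpace 0 y) ^ 2 := by
    nlinarith [abs_nonneg ρ₀, abs_nonneg a, sq_abs ρ₀, sq_abs a]
  nlinarith [Kerr.radius_nonneg a (E4.ofTimeSpace 0 y), le_abs_self ρ₀, abs_nonneg ρ₀]

/-- **A time-reversing motion contradicts (ℓ) + (e′).** If the motion of hole `i` reverses lab time
(`(Λᵢ w)⁰ = −w⁰` for all `w`), then clause (ℓ) fails: the identification points `Pᵢ Θᵢ (x − s e₀)` (`s → ∞`) have constant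
adapted radius (`≤ ρᵢ(lab time) + 1` eventually, by (e′)), lab time `→ +∞` and rest time `→ −∞`. [folklore] -/
theorem not_timeReversing_of_ell (d : StationaryFinalStateDecomposition 𝓢 O k) {M a c r₀ : Fin d.N → ℝ}
    {Θ : Fin d.N → E4 → E4} (i : Fin d.N)
    (hW : IsKerrChartedWith (d.hole i) (d.adapted i) (M i) (a i) (c i) (r₀ i) (Θ i)) (hc1 : c i = 1)
    (he' : Tendsto (d.toOver.excision i) atTop atTop)
    (hℓ : ∃ T : ℝ, ∀ y : (d.background i).domain, T < (y : E4) 0 →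
      (d.background i).radius y.1 ≤ d.toOver.excision i ((y : E4) 0) + 1 → d.toOver.τ₀ < (d.background i).time y.1)
    (hrev : ∀ w : E4, ((d.motion i).1 : E4 ≃L[ℝ] E4) w 0 = -w 0) : False := by
  obtain ⟨T, hT⟩ := hℓ
  obtain ⟨hsub, -, -, hr₀, -, -, hΘm, hΘe, -⟩ := hW
  have hrp : 0 < Kerr.rPlus (M i) (a i) := hsub.pos.trans_le (le_add_of_nonneg_right (Real.sqrt_nonneg _))
  have hsubreg : (Kerr.exterior (M i) (a i) : Set E4) ⊆ (Kerr.region (a i) (r₀ i) : Set E4) := fun z hz ↦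
    Kerr.mem_region.2 ((max_le_max hr₀.le le_rfl).trans_lt (Kerr.mem_exterior.1 hz))
  -- a point of the exterior and its adapted radius
  obtain ⟨x, hxr⟩ := exists_radius_ge_w5s (a i) (Kerr.rPlus (M i) (a i) + 1)
  have hx : x ∈ (Kerr.exterior (M i) (a i) : Set E4) := Kerr.mem_exterior.2 ((max_eq_left hrp.le).trans_lt (by linarith))
  set a₀ : ℝ := (d.adapted i).radius (Θ i x) with ha₀
  obtain ⟨T', hT'⟩ := eventually_atTop.1 (he'.eventually_ge_atTop (a₀ - 1))
  -- slide backwards in Kerr–Schild time by `s`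
  set s : ℝ := max (max (T - (d.motion i).2 0 + Θ i x 0 + 1) (T' - (d.motion i).2 0 + Θ i x 0)) (Θ i x 0 - d.toOver.τ₀)
    with hs
  have hxs : x + (-s) • E4.basisVector 0 ∈ (Kerr.exterior (M i) (a i) : Set E4) :=
    Kerr.add_smul_basisVector_zero_mem_region hx (-s)
  have hΘxs : Θ i (x + (-s) • E4.basisVector 0) = Θ i x + (-s) • E4.basisVector 0 := by
    have h := hΘe x (hsubreg hx) (-s); rwa [hc1, one_mul] at h
  set ys : E4 := ((d.motion i).1 : E4 ≃L[ℝ] E4) (Θ i (x + (-s) • E4.basisVector 0)) + (d.motion i).2 with hys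
  have hysdom : ys ∈ (d.background i).domain := by
    show poincareInv (d.motion i).1 (d.motion i).2 ys ∈ ((d.adapted i).domain : Set E4)
    rw [hys, poincareInv_apply_add]; exact hΘm (hsubreg hxs)
  have he00 : (E4.basisVector 0 : E4) 0 = 1 := by simp [E4.basisVector]
  have hlab : ys 0 = s - Θ i x 0 + (d.motion i).2 0 := by
    rw [hys, PiLp.add_apply, hrev, hΘxs, PiLp.add_apply, PiLp.smul_apply, he00]; ring
  have hrest : (d.background i).time ys = Θ i x 0 - s := by
    show poincareInv (d.motion i).1 (d.motion i).2 ys 0 = _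
    rw [hys, poincareInv_apply_add, hΘxs, PiLp.add_apply, PiLp.smul_apply, he00]; ring
  have hrad : (d.background i).radius ys = a₀ := by
    show (d.adapted i).radius (poincareInv (d.motion i).1 (d.motion i).2 ys) = a₀
    rw [hys, poincareInv_apply_add, hΘxs, adaptedRadius_add_smul_basisVector]
  have hs1 : T - (d.motion i).2 0 + Θ i x 0 + 1 ≤ s := (le_max_left _ _).trans (le_max_left _ _)
  have hs2 : T' - (d.motion i).2 0 + Θ i x 0 ≤ s := (le_max_right _ _).trans (le_max_left _ _)
  have hs3 : Θ i x 0 - d.toOver.τ₀ ≤ s := le_max_right _ _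
  have h := hT ⟨ys, hysdom⟩ (by rw [hlab]; linarith) (by
    rw [hrad, hlab]
    linarith [hT' (s - Θ i x 0 + (d.motion i).2 0) (by linarith)])
  rw [hrest] at h
  linarith

/-- **Registered helper `recutJunction_isochronous`**: Kerr identifications with `cᵢ = 1`, untilted motions (conclusion of
`recutJunction_noTilt`, hypothesis here), (e′) and (ℓ) give ISOCHRONOUS motions `Λᵢ e₀ = e₀` — the hypothesis of the
assembly `recutJunctionCoreCO_of_isochronous`. [folklore] -/
theorem recutJunction_isochronous : ∀ {𝓢 : Spacetime.{0} 4} {O : Set 𝓢.carrier} {k : ℕ} (d : StationaryFinalStateDecomposition 𝓢 O k) (M a c r₀ : Fin d.N → ℝ) (Θ : Fin d.N → E4 → E4), (∀ i, IsKerrChartedWith (d.hole i) (d.adapted i) (M i) (a i) (c i) (r₀ i) (Θ i)) → (∀ i, c i = 1) → (∀ i : Fin d.N, E4.spatial (((d.motion i).1 : E4 ≃L[ℝ] E4).symm (E4.basisVector 0)) = 0) → (∀ i : Fin d.N, Tendsto (d.toOver.excision i) atTop atTop) → (∀ i : Fin d.N, ∃ T : ℝ, ∀ y : (d.background i).domain,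 T < (y : E4) 0 → (d.background i).radius y.1 ≤ d.toOver.excision i ((y : E4) 0) + 1 → d.toOver.τ₀ < (d.background i).time y.1) → ∀ i : Fin d.N, ((d.motion i).1 : E4 ≃L[ℝ] E4) (E4.basisVector 0) = E4.basisVector 0 := by
  intro 𝓢 O k d M a c r₀ Θ hW hc1 hnoTilt he' hℓ i
  set Λ : lorentzGroup := (d.motion i).1 with hΛ
  set ut : E4 := (Λ : E4 ≃L[ℝ] E4).symm (E4.basisVector 0) with hut
  have hsp : E4.spatial ut = 0 := hnoTilt i
  have hsq := lorentz_symm_basisVector_sq Λ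
  rw [← hut, hsp, norm_zero] at hsq
  have hu : ut = ut 0 • E4.basisVector 0 := eq_smul_basisVector_of_spatial_eq_zero hsp
  have hcase : ut 0 = 1 ∨ ut 0 = -1 := by
    have h1 : (ut 0 - 1) * (ut 0 + 1) = 0 := by nlinarith [hsq]
    rcases mul_eq_zero.1 h1 with h | h
    · exact Or.inl (by linarith)
    · exact Or.inr (by linarith)
  rcases hcase with h1 | h1
  · -- `Λ⁻¹ e₀ = e₀`
    rw [h1, one_smul] at hu
    have h := congrArg (Λ : E4 ≃L[ℝ] E4) hu
    rw [hut, ContinuousLinearEquiv.apply_symm_apply] at h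
    exact h.symm
  · -- `Λ⁻¹ e₀ = −e₀`: a time-reversing motion, excluded by (ℓ) + (e′)
    exfalso
    refine not_timeReversing_of_ell d i (hW i) (hc1 i) (he' i) (hℓ i) fun w ↦ ?_
    rw [lorentz_apply_zero_eq_w5s, ← hut, hsp, inner_zero_left, sub_zero, h1]
    ring

end Sign

end Summit.FinalStateConjecture.FinalStateConjecture.Theorems.SymplecticDualOfTheBomb

end
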